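import Mathlib
import HarnessLib
import Summits.ResolutionOfSingularities.ResolutionOfSingularities.Theorems.HomologicalConductorNoZenoStableAnnihilatorReduction

/-!
# Crux `Persistence` (stmt-ResolutionOfSingularities-16484), chain W4.4b — LEMMA D in the kernel:
# stable annihilators of LATTICES over `A[z]/(z^{r+1})` are DIVISIBLE

Route `ResolutionOfSingularities/HomologicalConductor`.  OURS (cell res-hironaka, crux chain W4.4b,
`L/w44b/U12-SPEC.md` v2 §6 LEMMA D / COROLLARY 1 of the planner res-L1-w44b-plan-1; seat
res-D-pv-058, object «U14»); nothing here is a statement of the manuscript under review (Hironaka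
2017); AI-written, weaker than expert review.

SETTING (basis-free, def-free).  `A` a commutative ring, `R` a commutative `A`-algebra with a POWER
BASIS `pb : PowerBasis A R` whose generator `z := pb.gen` is NILPOTENT of index `pb.dim = r + 1`
(`hnil : pb.gen ^ pb.dim = 0`; so `R ≅ A[z]/(z^{r+1})` — e.g. `AdjoinRoot (X ^ (r+1))` with
`AdjoinRoot.powerBasis'`), `M` an `R`-module (`IsScalarTower A R M`) on which `z` acts as
`t • N₀` for a scalar `t : A` and an `A`-linear `N₀` (a LATTICE `(M, N = t·N₀)`), and
`StablyAnnihilates` the tree's stable annihilator (`x • 𝟙_M` factors through a finitely generated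
projective `R`-module).

* `repr_gen_mul_zero` / `repr_gen_mul_succ` — multiplication by `z` SHIFTS power-basis coordinates.
* `repr_linearMap_eq` (LEMMA D proper) — for an `R`-linear `α : M → R`, the `j`-th coordinate of
  `α` is the TOP coordinate of `α ∘ z^{r-j}`: every `α` is `v ↦ Σ_j λ(z^{r−j} v) z^j`, `λ =` top
  coordinate of `α`; `linearMap_apply_eq_sum` is the expansion.
* **`exists_smul_eq_pow_smul_of_stablyAnnihilates`** (LEMMA D + DIVISIBILITY): if `c ∈ R` stably
  annihilates `M`, then `c` acts on `M` as `t ^ r • Θ` for some `A`-linear `Θ : M → M` (a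
  factorisation through a f.g. projective is re-routed through `Rⁿ`; by LEMMA D it is
  `Σ_{l,j} λ_l(N^{r−j} v) N^j m_l = Σ N^j Θ_j N^{r−j}`, and `N = t N₀` makes every term divisible by
  `t^r`).
* **`not_stablyAnnihilates_of_basis`** (COROLLARY 1, the NOT-table for every `r` at once): if `M`
  is free over `A` on `e₀,…,e_{k−1}` with `z e₀ = 0`, `z e_{i+1} = t^γ e_i` (the lattice
  `(A^k, t^γ J_k)`), `a < k` and `t^{γ r} ∤ t^{γ a + c₀}`, then `z^a t^{c₀}` does NOT stably annihilate
  `M`; `not_stablyAnnihilates_of_basis_of_lt` is the form with `t` a non-zero non-unit and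
  `γ a + c₀ < γ r` (e.g. `A = K[t]`).  U12 (`z² ∉ s-ann(t·J₃)` over `A₃ × line`'s Knörrer partner)
  is the instance `r = 3, k = 3, γ = 1, a = 2, c₀ = 0`.

The bridge «coker of the matrix factorisation `(zI − t^γ J, Σ z^{r−j}(t^γ J)^j)` of `z^{r+1}` ≅ this
lattice» and the Knörrer transfer to `A_r × line` (U13) are separate files.  All `[folklore]`/OURS
elementary module theory; mechanism: U12-SPEC §6 (Lemma D), Knörrer 1987 / Eisenbud 1980 only as
motivation.
-/

noncomputable section

-- single-problem summit: the doubled namespace component `ResolutionOfSingularities` is forced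
set_option linter.dupNamespace false

open CategoryTheory
open Summit.ResolutionOfSingularities.ResolutionOfSingularities.Theorems.NoZeno.SandwichCluster

universe u v

namespace Summit.ResolutionOfSingularities.ResolutionOfSingularities.Theorems.HomologicalConductor.PersistenceLatticeDivisibility

variable {A : Type v} [CommRing A] {R : Type u} [CommRing R] [Algebra A R]

/-! ## Multiplication by a nilpotent power-basis generator shifts coordinates -/

/-- `z · z^i` in power-basis coordinates: `basis (i+1)` if `i + 1 < dim`, else `0` (`z^dim = 0`).
[folklore] -/
theorem gen_mul_basis (pb : PowerBasis A R) (hnil : pb.gen ^ pb.dim = 0) (i : Fin pb.dim) :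
    pb.gen * pb.basis i =
      if h : (i : ℕ) + 1 < pb.dim then pb.basis ⟨(i : ℕ) + 1, h⟩ else 0 := by
  rw [pb.basis_eq_pow, ← pow_succ']
  split_ifs with h
  · rw [pb.basis_eq_pow]
  · have hi : (i : ℕ) + 1 = pb.dim := by have := i.2; omega
    rw [hi, hnil]

/-- The `0`-th coordinate of `z · x` vanishes. [folklore] -/
theorem repr_gen_mul_zero (pb : PowerBasis A R) (hnil : pb.gen ^ pb.dim = 0) (h0 : 0 < pb.dim)
    (x : R) : pb.basis.repr (pb.gen * x) ⟨0, h0⟩ = 0 := by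
  suffices h : (Finsupp.lapply (⟨0, h0⟩ : Fin pb.dim)) ∘ₗ pb.basis.repr.toLinearMap ∘ₗ
      LinearMap.mulLeft A pb.gen = 0 from LinearMap.congr_fun h x
  refine pb.basis.ext fun i => ?_
  simp only [LinearMap.coe_comp, Function.comp_apply, LinearMap.mulLeft_apply,
    LinearEquiv.coe_coe, Finsupp.lapply_apply, LinearMap.zero_apply]
  rw [gen_mul_basis pb hnil]
  by_cases h : (i : ℕ) + 1 < pb.dim
  · rw [dif_pos h, pb.basis.repr_self, Finsupp.single_apply, if_neg]
    intro e
    have := Fin.ext_iff.mp e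
    simp at this
  · rw [dif_neg h, map_zero, Finsupp.zero_apply]

/-- The `(j+1)`-st coordinate of `z · x` is the `j`-th coordinate of `x`. [folklore] -/
theorem repr_gen_mul_succ (pb : PowerBasis A R) (hnil : pb.gen ^ pb.dim = 0) (j : ℕ)
    (hj : j + 1 < pb.dim) (x : R) :
    pb.basis.repr (pb.gen * x) ⟨j + 1, hj⟩ = pb.basis.repr x ⟨j, by omega⟩ := by
  suffices h : (Finsupp.lapply (⟨j + 1, hj⟩ : Fin pb.dim)) ∘ₗ pb.basis.repr.toLinearMap ∘ₗ
      LinearMap.mulLeft A pb.gen =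
      (Finsupp.lapply (⟨j, by omega⟩ : Fin pb.dim)) ∘ₗ pb.basis.repr.toLinearMap from
    LinearMap.congr_fun h x
  refine pb.basis.ext fun i => ?_
  simp only [LinearMap.coe_comp, Function.comp_apply, LinearMap.mulLeft_apply,
    LinearEquiv.coe_coe, Finsupp.lapply_apply]
  rw [gen_mul_basis pb hnil, pb.basis.repr_self, Finsupp.single_apply]
  by_cases h : (i : ℕ) + 1 < pb.dim
  · rw [dif_pos h, pb.basis.repr_self, Finsupp.single_apply]
    by_cases hij : (i : ℕ) = j
    · rw [if_pos (Fin.ext (by simp [hij])), if_pos (Fin.ext (by simp [hij]))]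
    · rw [if_neg (fun e => hij (by have := Fin.ext_iff.mp e; simp at this; omega)),
        if_neg (fun e => hij (by have := Fin.ext_iff.mp e; simpa using this))]
  · rw [dif_neg h, map_zero, Finsupp.zero_apply, if_neg]
    intro e
    have := Fin.ext_iff.mp e
    simp at this
    omega

/-! ## LEMMA D: `R`-linear functionals on an `R`-module are determined by their top coordinate -/

section LemmaD

variable (pb : PowerBasis A R) {M : Type u} [AddCommGroup M] [Module R M] [Module A M]
  [IsScalarTower A R M]

omit [Module A M] [IsScalarTower A R M] in
/-- **LEMMA D (coordinates).**  For an `R`-linear `α : M → R` and `n < dim`: the coordinate of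
index `dim - 1 - n` of `α v` equals the TOP coordinate (index `dim - 1`) of `α (z^n • v)`
(`α (z • v) = z · α v` and the shift). [OURS · U12-SPEC §6 Lemma D] -/
theorem repr_linearMap_eq (hnil : pb.gen ^ pb.dim = 0) (α : M →ₗ[R] R) (n : ℕ) (hn : n < pb.dim) (v : M) :
    pb.basis.repr (α v) ⟨pb.dim - 1 - n, by omega⟩ =
      pb.basis.repr (α ((pb.gen ^ n) • v)) ⟨pb.dim - 1, by omega⟩ := by
  induction n generalizing v with
  | zero => simp
  | succ n ih =>
    have h1 : pb.basis.repr (α v) ⟨pb.dim - 1 - (n + 1), by omega⟩ =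
        pb.basis.repr (pb.gen * α v) ⟨pb.dim - 1 - n, by omega⟩ := by
      have e : pb.dim - 1 - (n + 1) + 1 = pb.dim - 1 - n := by omega
      have := repr_gen_mul_succ pb hnil (pb.dim - 1 - (n + 1)) (by omega) (α v)
      rw [← this]
      exact congrArg _ (Fin.ext e)
    rw [h1, ← smul_eq_mul, ← map_smul, ih (by omega) (pb.gen • v), smul_smul, ← pow_succ]

omit [Module A M] [IsScalarTower A R M] in
/-- **LEMMA D (expansion).**  Every `R`-linear `α : M → R` is `v ↦ Σ_n λ(z^n • v) · z^{dim-1-n}`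
with `λ :=` the top power-basis coordinate of `α`. [OURS · U12-SPEC §6 Lemma D] -/
theorem linearMap_apply_eq_sum (hnil : pb.gen ^ pb.dim = 0) (α : M →ₗ[R] R) (hd : 0 < pb.dim) (v : M) :
    α v = ∑ n : Fin pb.dim,
      pb.basis.repr (α ((pb.gen ^ (n : ℕ)) • v)) ⟨pb.dim - 1, by omega⟩ •
        pb.gen ^ (pb.dim - 1 - (n : ℕ)) := by
  conv_lhs => rw [← pb.basis.sum_repr (α v)]
  rw [← Equiv.sum_comp Fin.revPerm]
  refine Finset.sum_congr rfl fun n _ => ?_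
  have hrev : ((Fin.revPerm n : Fin pb.dim) : ℕ) = pb.dim - 1 - (n : ℕ) := by
    rw [Fin.revPerm_apply, Fin.val_rev]
    omega
  rw [pb.basis_eq_pow, hrev]
  congr 1
  rw [← repr_linearMap_eq pb hnil α n n.2 v]
  exact congrArg _ (Fin.ext hrev)

/-- Powers of the generator act as powers of the lattice endomorphism: `z^n • m = t^n • N₀^n m`
when `z • m = t • N₀ m`. [folklore] -/
theorem gen_pow_smul_eq (t : A) (N₀ : M →ₗ[A] M) (hN : ∀ m : M, pb.gen • m = t • N₀ m)
    (n : ℕ) (m : M) : (pb.gen ^ n) • m = t ^ n • (N₀ ^ n) m := by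
  induction n generalizing m with
  | zero => simp
  | succ n ih =>
    rw [pow_succ', mul_smul, ih, smul_comm, hN, smul_smul, ← pow_succ, pow_succ' N₀ n,
      Module.End.mul_apply]

/-- **LEMMA D + DIVISIBILITY.**  Let `z = pb.gen` be nilpotent of index `dim`, and let `z` act on
the `R`-module `M` as `t • N₀` (`t : A`, `N₀` `A`-linear).  If `c ∈ R` STABLY ANNIHILATES `M`, then
`c` acts on `M` as `t ^ (dim - 1) • Θ` for some `A`-linear `Θ : M → M`.  (A factorisation
`M → P → M` of `c • 𝟙` through a f.g. projective `P` is re-routed through a free `Rⁿ ↠ P` by a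
section; through `Rⁿ` it reads `v ↦ Σ_l α_l(v) • m_l` with `α_l : M → R` `R`-linear; by LEMMA D
`α_l(v) • m_l = Σ_j λ_l(z^j v) z^{r−j} m_l = Σ_j t^j λ_l(N₀^j v) · t^{r−j} N₀^{r−j} m_l`.)
[OURS · U12-SPEC §6 Lemma D] -/
theorem exists_smul_eq_pow_smul_of_stablyAnnihilates (hnil : pb.gen ^ pb.dim = 0) (t : A)
    (N₀ : M →ₗ[A] M)
    (hN : ∀ m : M, pb.gen • m = t • N₀ m) {c : R}
    (h : StablyAnnihilates R c (ModuleCat.of R M)) :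
    ∃ Θ : M →ₗ[A] M, ∀ m : M, c • m = t ^ (pb.dim - 1) • Θ m := by
  rcases Nat.eq_zero_or_pos pb.dim with hd | hd
  · -- `dim = 0`: `R`, hence `M`, is trivial
    have h1 : (1 : R) = 0 := by
      haveI : IsEmpty (Fin pb.dim) := by rw [hd]; infer_instance
      simpa using (pb.basis.sum_repr (1 : R)).symm
    refine ⟨0, fun m => ?_⟩
    have hm : m = 0 := by rw [← one_smul R m, h1, zero_smul]
    simp [hm]
  obtain ⟨P, hPfin, hP, ι, π, hιπ⟩ := h
  haveI := hP
  haveI : Module.Projective R P := P.projective_of_module_projective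
  obtain ⟨n, f, hf⟩ := Module.Finite.exists_fin' R P
  obtain ⟨s, hs⟩ := Module.projective_lifting_property f LinearMap.id hf
  -- `c • v = Σ_l α_l(v) • w_l`
  let α : Fin n → M →ₗ[R] R := fun l => (LinearMap.proj l) ∘ₗ s ∘ₗ ι.hom
  let w : Fin n → M := fun l => π.hom (f (fun j => if l = j then 1 else 0))
  have hcv : ∀ v : M, c • v = ∑ l, α l v • w l := by
    intro v
    have h1 : π.hom (ι.hom v) = c • v := apply_apply_eq_smul_of_comp_eq_smul_id hιπ v
    have h2 : ι.hom v = f (s (ι.hom v)) := by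
      rw [← LinearMap.comp_apply, hs, LinearMap.id_apply]
    rw [← h1, h2, ← LinearMap.comp_apply, LinearMap.pi_apply_eq_sum_univ]
    rfl
  -- the top coordinate functionals `λ_l := top ∘ α_l`, as `A`-linear maps
  let lam : Fin n → M →ₗ[A] A := fun l =>
    (Finsupp.lapply (⟨pb.dim - 1, by omega⟩ : Fin pb.dim)) ∘ₗ pb.basis.repr.toLinearMap ∘ₗ
      (α l).restrictScalars A
  have hlam : ∀ l v, lam l v = pb.basis.repr (α l v) ⟨pb.dim - 1, by omega⟩ := fun l v => rfl
  refine ⟨∑ l : Fin n, ∑ j : Fin pb.dim,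
    (LinearMap.toSpanSingleton A M ((N₀ ^ (pb.dim - 1 - (j : ℕ))) (w l))) ∘ₗ (lam l) ∘ₗ
      (N₀ ^ (j : ℕ)), fun v => ?_⟩
  rw [hcv v]
  simp only [LinearMap.sum_apply, LinearMap.coe_comp, Function.comp_apply,
    LinearMap.toSpanSingleton_apply, Finset.smul_sum]
  refine Finset.sum_congr rfl fun l _ => ?_
  rw [linearMap_apply_eq_sum pb hnil (α l) hd v, Finset.sum_smul]
  refine Finset.sum_congr rfl fun j _ => ?_
  have hjle : (j : ℕ) ≤ pb.dim - 1 := by have := j.2; omega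
  rw [← hlam l, smul_assoc, gen_pow_smul_eq pb t N₀ hN, gen_pow_smul_eq pb t N₀ hN, map_smul,
    smul_eq_mul, smul_smul, smul_smul]
  congr 1
  rw [mul_right_comm, ← pow_add, Nat.add_sub_cancel' hjle]

end LemmaD

/-! ## COROLLARY 1: the lattices `(A^k, t^γ J_k)` -/

section Lattice

variable (pb : PowerBasis A R) {M : Type u} [AddCommGroup M] [Module R M] [Module A M]
  [IsScalarTower A R M]

/-- In a Jordan lattice `z e₀ = 0`, `z e_{i+1} = s e_i`: `z^a e_{i+a} = s^a e_i`. [folklore] -/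
theorem gen_pow_smul_basis {k : ℕ} (b : Module.Basis (Fin k) A M) (s : A)
    (hS : ∀ (i : ℕ) (h : i + 1 < k), pb.gen • b ⟨i + 1, h⟩ = s • b ⟨i, by omega⟩)
    (a i : ℕ) (hi : i + a < k) :
    (pb.gen ^ a) • b ⟨i + a, hi⟩ = s ^ a • b ⟨i, by omega⟩ := by
  induction a with
  | zero => simp
  | succ a ih =>
    show pb.gen ^ (a + 1) • b ⟨i + a + 1, hi⟩ = _
    rw [pow_succ, mul_smul, hS (i + a) hi, smul_comm, ih (by omega), smul_smul, ← pow_succ']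

/-- The Jordan shift of a lattice basis as an `A`-linear endomorphism `N₀` with `z • m = s • N₀ m`.
[folklore] -/
theorem exists_shift {k : ℕ} (b : Module.Basis (Fin k) A M) (s : A)
    (h0 : ∀ h : 0 < k, pb.gen • b ⟨0, h⟩ = 0)
    (hS : ∀ (i : ℕ) (h : i + 1 < k), pb.gen • b ⟨i + 1, h⟩ = s • b ⟨i, by omega⟩) :
    ∃ N₀ : M →ₗ[A] M, ∀ m : M, pb.gen • m = s • N₀ m := by
  let N₀ : M →ₗ[A] M :=
    b.constr A fun i : Fin k => if h : (i : ℕ) = 0 then (0 : M) else b ⟨(i : ℕ) - 1, by omega⟩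
  refine ⟨N₀, fun m => ?_⟩
  suffices h : ((LinearMap.lsmul R M pb.gen).restrictScalars A) = s • N₀ from
    LinearMap.congr_fun h m
  refine b.ext fun i => ?_
  obtain ⟨iv, hiv⟩ := i
  rw [LinearMap.restrictScalars_apply, LinearMap.lsmul_apply, LinearMap.smul_apply,
    Module.Basis.constr_basis]
  cases iv with
  | zero =>
    rw [dif_pos rfl, smul_zero]
    exact h0 hiv
  | succ i' =>
    rw [dif_neg (Nat.succ_ne_zero i'), hS i' hiv]
    congr 2

/-- **COROLLARY 1 (the NOT-table of U12-SPEC §4/§6 for every `r` at once).**  Let `z = pb.gen`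
be nilpotent of index `dim = r + 1` and let `M` be free over `A` on `e₀, …, e_{k−1}` with
`z e₀ = 0`, `z e_{i+1} = t^γ e_i` (the lattice `(A^k, t^γ J_k)`; automatically `k ≤ r + 1`).  If
`a < k` and `t^{γ r}` does NOT divide `t^{γ a + c₀}`, then `z^a t^{c₀}` does NOT stably annihilate
`M`: by LEMMA D it would act as `t^{γ r} • Θ`, but on `e_a` it acts as `t^{γ a + c₀} e₀`.
[OURS · U12-SPEC §6 Corollary 1] -/
theorem not_stablyAnnihilates_of_basis (hnil : pb.gen ^ pb.dim = 0) (t : A) (γ : ℕ) {k : ℕ}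
    (b : Module.Basis (Fin k) A M)
    (h0 : ∀ h : 0 < k, pb.gen • b ⟨0, h⟩ = 0)
    (hS : ∀ (i : ℕ) (h : i + 1 < k), pb.gen • b ⟨i + 1, h⟩ = t ^ γ • b ⟨i, by omega⟩)
    (a c₀ : ℕ) (ha : a < k) (ht : ¬ t ^ (γ * (pb.dim - 1)) ∣ t ^ (γ * a + c₀)) :
    ¬ StablyAnnihilates R (pb.gen ^ a * algebraMap A R (t ^ c₀)) (ModuleCat.of R M) := by
  intro h
  obtain ⟨N₀, hN⟩ := exists_shift pb b (t ^ γ) h0 hS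
  obtain ⟨Θ, hΘ⟩ := exists_smul_eq_pow_smul_of_stablyAnnihilates pb hnil (t ^ γ) N₀ hN h
  have key := hΘ (b ⟨0 + a, by omega⟩)
  rw [mul_smul, algebraMap_smul, smul_comm, gen_pow_smul_basis pb b (t ^ γ) hS a 0 (by omega)]
    at key
  have := congrArg (b.coord ⟨0, by omega⟩) key
  simp only [map_smul, Module.Basis.coord_apply, b.repr_self, Finsupp.single_eq_same, smul_eq_mul,
    mul_one] at this
  rw [← pow_mul, ← pow_mul, mul_comm (t ^ c₀), ← pow_add] at this
  exact ht (Dvd.intro _ this.symm)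

/-- COROLLARY 1 with the divisibility hypothesis in DEGREE form: `t` a non-zero non-unit of a domain
(e.g. `t = X` in `A = K[X]`) and `γ a + c₀ < γ r`. [OURS · U12-SPEC §6 Corollary 1] -/
theorem not_stablyAnnihilates_of_basis_of_lt [IsDomain A] (hnil : pb.gen ^ pb.dim = 0) (t : A)
    (ht0 : t ≠ 0) (htu : ¬ IsUnit t) (γ : ℕ) {k : ℕ} (b : Module.Basis (Fin k) A M)
    (h0 : ∀ h : 0 < k, pb.gen • b ⟨0, h⟩ = 0)
    (hS : ∀ (i : ℕ) (h : i + 1 < k), pb.gen • b ⟨i + 1, h⟩ = t ^ γ • b ⟨i, by omega⟩)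
    (a c₀ : ℕ) (ha : a < k) (hlt : γ * a + c₀ < γ * (pb.dim - 1)) :
    ¬ StablyAnnihilates R (pb.gen ^ a * algebraMap A R (t ^ c₀)) (ModuleCat.of R M) :=
  not_stablyAnnihilates_of_basis pb hnil t γ b h0 hS a c₀ ha
    (by rw [pow_dvd_pow_iff ht0 htu]; omega)

end Lattice

end Summit.ResolutionOfSingularities.ResolutionOfSingularities.Theorems.HomologicalConductor.PersistenceLatticeDivisibility
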